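/-
Copyright (c) 2026 the pub-hodgecm-mathlib formalisation cell (harness21).  Prover seat hodgecm-mathlib-K2E4-p18 (g3), HCML Track B «K2-LIT» ∕ h413
(stmt-HodgeConjecture-24833); deal K2E3-plan (g1) 2026-09-03T23:32:58Z (b) «(H) … K2E4-p18 (g3) for the INDEP-from-homogeneity half», line lead K2E4-p06 (g2).
-/
import Summits.HodgeConjecture.HodgeConjecture.Theorems.K2E3SingularTransferSignedOfLimitFormulas   -- ★ p855452 (K2E4-p06): the frame-light imports of unit U3b
import Summits.HodgeConjecture.HodgeConjecture.Theorems.F0P3cStCharTSGermThree                     -- ★ (ALG) `eq_zero_of_eventuallyEq_const_nhdsWithin_of_seq` (growing powers along a ray)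
import HarnessLib

/-!
# K2 · E3 — `Theorems/K2E3CentralGermIndependenceOfHomogeneityRay.lean`: SUB-LETTER (H) «INDEPENDENCE OF THE NON-CENTRAL GERMS FROM THE CONSTANTS»
# FROM HOMOGENEITY ALONG ONE ELLIPTIC RAY (Rogawski 1990 §8.1 Prop. 8.1.2 (b), (8.1.1)–(8.1.2) p. 117)

HCML Track B «K2-LIT», cell `pub/hodgecm-mathlib`, crux H413 = `stmt-HodgeConjecture-24833` (lane `--supports … --as helper`); seat `hodgecm-mathlib-K2E4-p18` (g3).
Line (ii′) of unit U3b (`Cruxes/H413/Lines/K2_E3_EllipticInputsSigs_U3bCentralGerms.lean` ED. 3, K2E3-plan (g1) 23:32:58Z): the core (ii♭′) `sig_K2E3CentralGermExpansionH`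
is REL ⟸ (E)(H)(S) by ★ p855653 `K2E3CentralGermExpansionHOfGermLetters.centralGermExpansionH_of_letters` (K2E4-p06 (g2)).  THIS FILE pays the INDEPENDENCE half of
(H) `sig_K2E3CentralGermIndependence` (cand abbe57174b18d6b3, hosted verbatim in ED. 3): **(H) ⟸ (HOM-ray)**, where (HOM-ray) `sig_K2E3CentralGermHomogeneityRay`
(cand BYTES `K2/K2E4-p18/g3/sig_K2E3CentralGermHomogeneityRay.cand.K2E4-p18-g3.lean`, same frame-light prefix token for token) is the HOMOGENEITY half — the
central-point, rank-one twin of U3-d `sig_K2E3ShalikaGermHomogeneityRay`: along ONE ray `γ_n → z` of elliptic `G`-regular elements every non-central germ of the datum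
is an exact growing power `Γ_u(γ_n) = q^{n·a_u}·g_u` (`‖q‖ > 1`, `a_u ≥ 1`, `n ≥ n₀`) [Prop. 8.1.2 (b): `d(u_reg) = 2` on Cayley `t²`-rays; K2E5-p12 (g0)'s Cayley N = 2 road].

THE MATHEMATICS ([Rogawski1990, p. 117 (8.1.1)–(8.1.2)]: «`A(t)` is a linear combination of functions `|t|^{−a}` with `a > 0` … either identically zero or unbounded»).
Let `c₀ + Σ_{u ∈ S} a_u Γ_u(γ) = 0` for the elliptic `G`-regular `γ` near `z`, with `a_{⟦z⟧} = 0`.  The ray `γ_n` lies in the elliptic `G`-regular set and tends to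
`z`, so it is eventually inside the neighbourhood: `Σ_{u ≠ ⟦z⟧} (a_u g_u q^{n₀ a_u})·(q^{a_u})^{n} = −c₀` for all large `n` (re-indexed from `n₀`).  An eventually
CONSTANT combination of the pairwise growing powers `q^{n·a}` (`a ≥ 1`, `‖q‖ > 1`) has constant `0` — the polynomial `Σ_u C_u X^{a_u} + c₀` vanishes at the
infinitely many distinct points `q^n` (★ `F0P3cStCharTSGermThree.eq_zero_of_eventuallyEq_const_nhdsWithin_of_seq` ∕ `eq_zero_of_eventually_sum_mul_pow_eq`).  Hence
`c₀ = 0`.  No value of the central germ, no measure theory and no uniqueness of germs is used at this junction: those live in (HOM-ray)'s producer road.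

* §1 `eq_zero_of_eventually_const_add_sum_eq_zero_of_ray` — the abstract junction (any topological space, any index type, a distinguished index with coefficient `0`,
  homogeneity from an index `n₀` on).
* §2 **`centralGermIndependence_of_homogeneityRay : ‹(HOM-ray)› → ‹(H)›`** — THE HEAD; hypothesis = the cand socket `sig_K2E3CentralGermHomogeneityRay` VERBATIM,
  conclusion = (H) `sig_K2E3CentralGermIndependence` (abbe57174b18d6b3) VERBATIM, so that U3b's next edition can tie (H) := this ∘ (HOM-ray) by `exact`.

HONEST LABEL: HC_CM is proved only modulo the 7 printed citations (2 remaining named inputs: hLiu418 = stmt-HodgeConjecture-24832, h413 = stmt-HodgeConjecture-24833) until rung 0 closes.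
Count-neutral helper: (H) becomes REL ⟸ (HOM-ray) (REL ≠ ★); (HOM-ray) is OPEN (K2E5-p12 (g0) Cayley N = 2 twin + the «unique as germs» transport).  No `sorry`,
axioms ⊆ {propext, Classical.choice, Quot.sound}, no `def`, no instance, no notation.

## References
* [Rogawski1990] J. D. Rogawski, *Automorphic Representations of Unitary Groups in Three Variables*, Ann. of Math. Stud. 123 (1990): §8.1 Prop. 8.1.1 pp. 112–113
  («unique as germs»), Prop. 8.1.2 (a)(b) pp. 114–115, (8.1.1)–(8.1.2) p. 117; Lemma 12.7.2 (proof) pp. 194–195.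
* [HarishChandra1999AdmissibleDistributions] Harish-Chandra (notes by S. DeBacker, P. J. Sally, Jr.), *Admissible Invariant Distributions on Reductive p-adic Groups*,
  AMS ULS 16 (1999): Thm. 8.1 (1) p. 48 (homogeneity of Shalika germs).
-/

set_option autoImplicit false
set_option linter.dupNamespace false

noncomputable section

open Filter Topology
open MeasureTheory Measure NumberField IsDedekindDomain
open Literature.MeasureTheory.Group Literature.MeasureTheory.RestrictedProduct
open Literature.Topology.RestrictedProduct Literature.Topology.Algebra.RestrictedProduct
open Literature.NumberTheory.Rogawski1990 Literature.NumberTheory.Automorphic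
open Literature.AlgebraicGeometry.ShimuraVarieties (unitaryGroup hermForm)
open scoped Matrix MatrixGroups RestrictedProduct

namespace Summit.HodgeConjecture.HodgeConjecture.Cruxes.H413.K2E3CentralGermIndependenceOfHomogeneityRay

/-! ## §1 The abstract junction: an eventually-vanishing «constant + combination of growing powers» has constant zero -/

/-- **(ALG) AT A DISTINGUISHED INDEX.**  `G` a topological space, `A ⊆ G`, `x₀ ∈ G`; `Γ_u : G → ℂ` indexed by a finite set `S ∋ u₀`-or-not; a sequence `γ_n ∈ A`
tending to `x₀` along which `Γ_u(γ_n) = q^{n·a_u}·g_u` for `n ≥ n₀` and every `u ∈ S`, `u ≠ u₀` (`‖q‖ > 1`, `a_u ≥ 1`).  If `c₀ + Σ_{u ∈ S} κ_u·Γ_u(γ) = 0` for `γ`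
near `x₀` within `A` and `κ_{u₀} = 0`, then `c₀ = 0`: drop the `u₀`-term, re-index the ray from `n₀`, and read the constant coefficient of the polynomial
`Σ_u κ_u g_u q^{n₀ a_u} X^{a_u} + c₀`, which vanishes at the distinct points `q^n` (★ `eq_zero_of_eventuallyEq_const_nhdsWithin_of_seq`).
[cite: Rogawski1990, §8.1 (8.1.1)–(8.1.2) p. 117; Prop. 8.1.2 (b) p. 114] -/
theorem eq_zero_of_eventually_const_add_sum_eq_zero_of_ray {G : Type*} [TopologicalSpace G] {A : Set G} {x₀ : G} {ι : Type*}
    (S : Finset ι) (u₀ : ι) (Γ : ι → G → ℂ) (γseq : ℕ → G) (hmem : ∀ n, γseq n ∈ A) (hlim : Tendsto γseq atTop (𝓝 x₀))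
    (q : ℂ) (hq : 1 < ‖q‖) (a : ι → ℕ) (ha : ∀ u ∈ S, u ≠ u₀ → 1 ≤ a u) (g : ι → ℂ) (n₀ : ℕ)
    (hhom : ∀ u ∈ S, u ≠ u₀ → ∀ n, n₀ ≤ n → Γ u (γseq n) = q ^ (n * a u) * g u)
    (c₀ : ℂ) (κ : ι → ℂ) (hκ : κ u₀ = 0)
    (hev : ∀ᶠ γ in 𝓝[A] x₀, c₀ + ∑ u ∈ S, κ u * Γ u γ = 0) : c₀ = 0 := by
  classical
  -- drop the `u₀`-term (its coefficient vanishes) and move the constant to the right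
  have hev' : ∀ᶠ γ in 𝓝[A] x₀, (∑ u ∈ S.erase u₀, κ u * Γ u γ) = -c₀ := by
    filter_upwards [hev] with γ hγ
    rw [Finset.sum_erase S (by rw [hκ, zero_mul] : κ u₀ * Γ u₀ γ = 0)]
    linear_combination hγ
  -- re-index the ray from `n₀`
  have hmem' : ∀ n, γseq (n₀ + n) ∈ A := fun n => hmem (n₀ + n)
  have hlim' : Tendsto (fun n => γseq (n₀ + n)) atTop (𝓝 x₀) :=
    hlim.comp (tendsto_atTop_atTop_of_monotone (fun m n hmn => Nat.add_le_add_left hmn n₀) fun b => ⟨b, Nat.le_add_left b n₀⟩)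
  have ha' : ∀ u ∈ S.erase u₀, 0 < a u := fun u hu =>
    ha u (Finset.mem_of_mem_erase hu) (Finset.ne_of_mem_erase hu)
  have hhom' : ∀ u ∈ S.erase u₀, ∀ n, Γ u (γseq (n₀ + n)) = q ^ (n * a u) * (q ^ (n₀ * a u) * g u) := by
    intro u hu n
    rw [hhom u (Finset.mem_of_mem_erase hu) (Finset.ne_of_mem_erase hu) (n₀ + n) (Nat.le_add_right n₀ n), add_mul, pow_add]
    ring
  have h0 : (-c₀ : ℂ) = 0 :=
    Summit.HodgeConjecture.HodgeConjecture.Cruxes.H413.F0P3cStCharTSGermThree.eq_zero_of_eventuallyEq_const_nhdsWithin_of_seq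
      (S.erase u₀) κ Γ (fun n => γseq (n₀ + n)) hmem' hlim' q hq a ha' (fun u => q ^ (n₀ * a u) * g u) hhom' (-c₀) hev'
  exact neg_eq_zero.1 h0

/-! ## §2 The head: (H) `sig_K2E3CentralGermIndependence` from (HOM-ray) `sig_K2E3CentralGermHomogeneityRay`, token for token -/

/-- **(H) ⟸ (HOM-ray): INDEPENDENCE OF THE NON-CENTRAL GERMS FROM THE CONSTANTS, from homogeneity along one elliptic ray.**  Hypothesis = the cand socket
`…K2E3EllipticInputs.U3bCentralGerms.sig_K2E3CentralGermHomogeneityRay` VERBATIM (for every (E)-datum `(S, mU, Γ)` at a central `z` of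
`H_v = U(Φ₂)(L⁺_v) × U(Φ₁)(L⁺_v)`, `v` non-split: a ray `γ_n → z` of elliptic `G`-regular elements with `Γ_u(γ_n) = q^{n·a_u}·g_u`, `‖q‖ > 1`, `a_u ≥ 1`, `n ≥ n₀`,
`u ≠ ⟦z⟧`); conclusion = (H) `…U3bCentralGerms.sig_K2E3CentralGermIndependence` (cand abbe57174b18d6b3) VERBATIM: `c₀ + Σ_{u∈S} a_u Γ_u ≡ 0` near `z` on the elliptic
`G`-regular set with `a_{⟦z⟧} = 0` forces `c₀ = 0`.  The datum's expansion identity, admissibility and integrability clauses are carried, not used: the junction is §1.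
[cite: Rogawski1990, §8.1 Prop. 8.1.2 (b) pp. 114–115; (8.1.1)–(8.1.2) p. 117] -/
theorem centralGermIndependence_of_homogeneityRay
    (hray :
    ∀ (L : Type) [Field L] [NumberField L] [IsCMField L] (H' : Matrix (Fin 3) (Fin 3) L),
      (H'.map (cmConjRingHom L)).transpose = H' →
      (∀ x : Fin 3 → L, hermForm (cmConjRingHom L) H' x x = 0 → x = 0) →
    ∀ (v : HeightOneSpectrum (𝓞 ↥(maximalRealSubfield L)))
      [MeasurableSpace ((UnitaryGroup.cmDatum L 2 (Matrix.of fun i j : Fin 2 => if i.val + j.val + 1 = 2 then (1 : L) else 0)).Local v × (UnitaryGroup.cmDatum L 1 (Matrix.of fun i j : Fin 1 => if i.val + j.val + 1 = 1 then (1 : L) else 0)).Local v)] [BorelSpace ((UnitaryGroup.cmDatum L 2 (Matrix.of fun i j : Fin 2 => if i.val + j.val + 1 = 2 then (1 : L) else 0)).Local v × (UnitaryGroup.cmDatum L 1 (Matrix.of fun i j : Fin 1 => if i.val + j.val + 1 = 1 then (1 : L) else 0)).Local v)]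
      [∀ a : (UnitaryGroup.cmDatum L 2 (Matrix.of fun i j : Fin 2 => if i.val + j.val + 1 = 2 then (1 : L) else 0)).Local v × (UnitaryGroup.cmDatum L 1 (Matrix.of fun i j : Fin 1 => if i.val + j.val + 1 = 1 then (1 : L) else 0)).Local v,
        MeasurableSpace (((UnitaryGroup.cmDatum L 2 (Matrix.of fun i j : Fin 2 => if i.val + j.val + 1 = 2 then (1 : L) else 0)).Local v × (UnitaryGroup.cmDatum L 1 (Matrix.of fun i j : Fin 1 => if i.val + j.val + 1 = 1 then (1 : L) else 0)).Local v) ⧸ Subgroup.centralizer ({a} : Set ((UnitaryGroup.cmDatum L 2 (Matrix.of fun i j : Fin 2 => if i.val + j.val + 1 = 2 then (1 : L) else 0)).Local v × (UnitaryGroup.cmDatum L 1 (Matrix.of fun i j : Fin 1 => if i.val + j.val + 1 = 1 then (1 : L) else 0)).Local v)))]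
      [∀ a : (UnitaryGroup.cmDatum L 2 (Matrix.of fun i j : Fin 2 => if i.val + j.val + 1 = 2 then (1 : L) else 0)).Local v × (UnitaryGroup.cmDatum L 1 (Matrix.of fun i j : Fin 1 => if i.val + j.val + 1 = 1 then (1 : L) else 0)).Local v,
        BorelSpace (((UnitaryGroup.cmDatum L 2 (Matrix.of fun i j : Fin 2 => if i.val + j.val + 1 = 2 then (1 : L) else 0)).Local v × (UnitaryGroup.cmDatum L 1 (Matrix.of fun i j : Fin 1 => if i.val + j.val + 1 = 1 then (1 : L) else 0)).Local v) ⧸ Subgroup.centralizer ({a} : Set ((UnitaryGroup.cmDatum L 2 (Matrix.of fun i j : Fin 2 => if i.val + j.val + 1 = 2 then (1 : L) else 0)).Local v × (UnitaryGroup.cmDatum L 1 (Matrix.of fun i j : Fin 1 => if i.val + j.val + 1 = 1 then (1 : L) else 0)).Local v)))]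
      [MeasurableSpace ((UnitaryGroup.cmDatum L 3 H').Local v)] [BorelSpace ((UnitaryGroup.cmDatum L 3 H').Local v)]
      [∀ γ : (UnitaryGroup.cmDatum L 3 H').Local v, MeasurableSpace ((UnitaryGroup.cmDatum L 3 H').Local v ⧸ Subgroup.centralizer ({γ} : Set ((UnitaryGroup.cmDatum L 3 H').Local v)))]
      [∀ γ : (UnitaryGroup.cmDatum L 3 H').Local v, BorelSpace ((UnitaryGroup.cmDatum L 3 H').Local v ⧸ Subgroup.centralizer ({γ} : Set ((UnitaryGroup.cmDatum L 3 H').Local v)))]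
      (νHv : Measure ((UnitaryGroup.cmDatum L 2 (Matrix.of fun i j : Fin 2 => if i.val + j.val + 1 = 2 then (1 : L) else 0)).Local v × (UnitaryGroup.cmDatum L 1 (Matrix.of fun i j : Fin 1 => if i.val + j.val + 1 = 1 then (1 : L) else 0)).Local v)) (νGv : Measure ((UnitaryGroup.cmDatum L 3 H').Local v))
      [IsFiniteMeasureOnCompacts νHv] [νHv.IsMulRightInvariant] [νGv.IsHaarMeasure] [νGv.IsMulRightInvariant]
      (Δv : LocalTransferFactor L H' v)
      (mHv : OrbitalMeasureFamily ((UnitaryGroup.cmDatum L 2 (Matrix.of fun i j : Fin 2 => if i.val + j.val + 1 = 2 then (1 : L) else 0)).Local v × (UnitaryGroup.cmDatum L 1 (Matrix.of fun i j : Fin 1 => if i.val + j.val + 1 = 1 then (1 : L) else 0)).Local v)) (mGv : OrbitalMeasureFamily ((UnitaryGroup.cmDatum L 3 H').Local v)),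
      IsLocalTransferDatum L H' v Δv mHv mGv →
      mHv.IsCanonical (IsLocalGRegular L v) νHv →
      mGv.IsCanonical (fun γ : (UnitaryGroup.cmDatum L 3 H').Local v => IsRegularElt (γ.val : GL (Fin 3) (UnitaryGroup.LocalRing L v))) νGv →
      Subsingleton (UnitaryGroup.PlacesOver L v) →
    ∀ z : (UnitaryGroup.cmDatum L 2 (Matrix.of fun i j : Fin 2 => if i.val + j.val + 1 = 2 then (1 : L) else 0)).Local v × (UnitaryGroup.cmDatum L 1 (Matrix.of fun i j : Fin 1 => if i.val + j.val + 1 = 1 then (1 : L) else 0)).Local v, z ∈ Subgroup.center ((UnitaryGroup.cmDatum L 2 (Matrix.of fun i j : Fin 2 => if i.val + j.val + 1 = 2 then (1 : L) else 0)).Local v × (UnitaryGroup.cmDatum L 1 (Matrix.of fun i j : Fin 1 => if i.val + j.val + 1 = 1 then (1 : L) else 0)).Local v) →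
    ∀ (S : Finset (ConjClasses ((UnitaryGroup.cmDatum L 2 (Matrix.of fun i j : Fin 2 => if i.val + j.val + 1 = 2 then (1 : L) else 0)).Local v × (UnitaryGroup.cmDatum L 1 (Matrix.of fun i j : Fin 1 => if i.val + j.val + 1 = 1 then (1 : L) else 0)).Local v))) (mU : OrbitalMeasureFamily ((UnitaryGroup.cmDatum L 2 (Matrix.of fun i j : Fin 2 => if i.val + j.val + 1 = 2 then (1 : L) else 0)).Local v × (UnitaryGroup.cmDatum L 1 (Matrix.of fun i j : Fin 1 => if i.val + j.val + 1 = 1 then (1 : L) else 0)).Local v))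
      (Γ : ConjClasses ((UnitaryGroup.cmDatum L 2 (Matrix.of fun i j : Fin 2 => if i.val + j.val + 1 = 2 then (1 : L) else 0)).Local v × (UnitaryGroup.cmDatum L 1 (Matrix.of fun i j : Fin 1 => if i.val + j.val + 1 = 1 then (1 : L) else 0)).Local v) → (UnitaryGroup.cmDatum L 2 (Matrix.of fun i j : Fin 2 => if i.val + j.val + 1 = 2 then (1 : L) else 0)).Local v × (UnitaryGroup.cmDatum L 1 (Matrix.of fun i j : Fin 1 => if i.val + j.val + 1 = 1 then (1 : L) else 0)).Local v → ℂ),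
      ConjClasses.mk z ∈ S →
      (∀ u ∈ S, ((((Quotient.out u * z⁻¹).1).val : GL (Fin 2) (UnitaryGroup.LocalRing L v)).val - 1) ^ 2 = 0 ∧ (Quotient.out u * z⁻¹).2 = 1) →
      mU.IsAdmissibleOn (fun γ : (UnitaryGroup.cmDatum L 2 (Matrix.of fun i j : Fin 2 => if i.val + j.val + 1 = 2 then (1 : L) else 0)).Local v × (UnitaryGroup.cmDatum L 1 (Matrix.of fun i j : Fin 1 => if i.val + j.val + 1 = 1 then (1 : L) else 0)).Local v => ConjClasses.mk γ ∈ S) →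
      (∀ u ∈ S, ∀ fH : (UnitaryGroup.cmDatum L 2 (Matrix.of fun i j : Fin 2 => if i.val + j.val + 1 = 2 then (1 : L) else 0)).Local v × (UnitaryGroup.cmDatum L 1 (Matrix.of fun i j : Fin 1 => if i.val + j.val + 1 = 1 then (1 : L) else 0)).Local v → ℂ, IsLocSmooth fH →
        Integrable (descConj (Quotient.out u : (UnitaryGroup.cmDatum L 2 (Matrix.of fun i j : Fin 2 => if i.val + j.val + 1 = 2 then (1 : L) else 0)).Local v × (UnitaryGroup.cmDatum L 1 (Matrix.of fun i j : Fin 1 => if i.val + j.val + 1 = 1 then (1 : L) else 0)).Local v) (Subgroup.centralizer ({(Quotient.out u : (UnitaryGroup.cmDatum L 2 (Matrix.of fun i j : Fin 2 => if i.val + j.val + 1 = 2 then (1 : L) else 0)).Local v × (UnitaryGroup.cmDatum L 1 (Matrix.of fun i j : Fin 1 => if i.val + j.val + 1 = 1 then (1 : L) else 0)).Local v)} : Set ((UnitaryGroup.cmDatum L 2 (Matrix.of fun i j : Fin 2 => if i.val + j.val + 1 = 2 then (1 : L) else 0)).Local v × (UnitaryGroup.cmDatum L 1 (Matrix.of fun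 i j : Fin 1 => if i.val + j.val + 1 = 1 then (1 : L) else 0)).Local v)))
          (fun _ hg => Subgroup.mem_centralizer_singleton_iff.1 hg) fH) (mU u)) →
      (∀ fH : (UnitaryGroup.cmDatum L 2 (Matrix.of fun i j : Fin 2 => if i.val + j.val + 1 = 2 then (1 : L) else 0)).Local v × (UnitaryGroup.cmDatum L 1 (Matrix.of fun i j : Fin 1 => if i.val + j.val + 1 = 1 then (1 : L) else 0)).Local v → ℂ, IsLocSmooth fH → ∀ᶠ γ in 𝓝[{γ : (UnitaryGroup.cmDatum L 2 (Matrix.of fun i j : Fin 2 => if i.val + j.val + 1 = 2 then (1 : L) else 0)).Local v × (UnitaryGroup.cmDatum L 1 (Matrix.of fun i j : Fin 1 => if i.val + j.val + 1 = 1 then (1 : L) else 0)).Local v |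
            IsLocalGRegular L v γ ∧ CompactSpace (Subgroup.centralizer ({γ} : Set ((UnitaryGroup.cmDatum L 2 (Matrix.of fun i j : Fin 2 => if i.val + j.val + 1 = 2 then (1 : L) else 0)).Local v × (UnitaryGroup.cmDatum L 1 (Matrix.of fun i j : Fin 1 => if i.val + j.val + 1 = 1 then (1 : L) else 0)).Local v)))}] z,
          stableOrbitalIntegralRel (IsLocalStablyConjH L v) mHv fH γ = ∑ u ∈ S, classOrbitalIntegral mU fH u * Γ u γ) →
    ∃ (γseq : ℕ → (UnitaryGroup.cmDatum L 2 (Matrix.of fun i j : Fin 2 => if i.val + j.val + 1 = 2 then (1 : L) else 0)).Local v × (UnitaryGroup.cmDatum L 1 (Matrix.of fun i j : Fin 1 => if i.val + j.val + 1 = 1 then (1 : L) else 0)).Local v) (q : ℂ) (a : ConjClasses ((UnitaryGroup.cmDatum L 2 (Matrix.of fun i j : Fin 2 => if i.val + j.val + 1 = 2 then (1 : L) else 0)).Local v × (UnitaryGroup.cmDatum L 1 (Matrix.of fun i j : Fin 1 => if i.val + j.val + 1 = 1 then (1 : L) else 0)).Local v) → ℕ) (g : ConjClasses ((UnitaryGroup.cmDatum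 L 2 (Matrix.of fun i j : Fin 2 => if i.val + j.val + 1 = 2 then (1 : L) else 0)).Local v × (UnitaryGroup.cmDatum L 1 (Matrix.of fun i j : Fin 1 => if i.val + j.val + 1 = 1 then (1 : L) else 0)).Local v) → ℂ) (n₀ : ℕ),
      (∀ n, IsLocalGRegular L v (γseq n) ∧ CompactSpace (Subgroup.centralizer ({γseq n} : Set ((UnitaryGroup.cmDatum L 2 (Matrix.of fun i j : Fin 2 => if i.val + j.val + 1 = 2 then (1 : L) else 0)).Local v × (UnitaryGroup.cmDatum L 1 (Matrix.of fun i j : Fin 1 => if i.val + j.val + 1 = 1 then (1 : L) else 0)).Local v)))) ∧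
      Tendsto γseq atTop (𝓝 z) ∧ 1 < ‖q‖ ∧
      (∀ u ∈ S, u ≠ ConjClasses.mk z → 1 ≤ a u) ∧
      ∀ u ∈ S, u ≠ ConjClasses.mk z → ∀ n, n₀ ≤ n → Γ u (γseq n) = q ^ (n * a u) * g u) :
    ∀ (L : Type) [Field L] [NumberField L] [IsCMField L] (H' : Matrix (Fin 3) (Fin 3) L),
      (H'.map (cmConjRingHom L)).transpose = H' →
      (∀ x : Fin 3 → L, hermForm (cmConjRingHom L) H' x x = 0 → x = 0) →
    ∀ (v : HeightOneSpectrum (𝓞 ↥(maximalRealSubfield L)))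
      [MeasurableSpace ((UnitaryGroup.cmDatum L 2 (Matrix.of fun i j : Fin 2 => if i.val + j.val + 1 = 2 then (1 : L) else 0)).Local v × (UnitaryGroup.cmDatum L 1 (Matrix.of fun i j : Fin 1 => if i.val + j.val + 1 = 1 then (1 : L) else 0)).Local v)] [BorelSpace ((UnitaryGroup.cmDatum L 2 (Matrix.of fun i j : Fin 2 => if i.val + j.val + 1 = 2 then (1 : L) else 0)).Local v × (UnitaryGroup.cmDatum L 1 (Matrix.of fun i j : Fin 1 => if i.val + j.val + 1 = 1 then (1 : L) else 0)).Local v)]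
      [∀ a : (UnitaryGroup.cmDatum L 2 (Matrix.of fun i j : Fin 2 => if i.val + j.val + 1 = 2 then (1 : L) else 0)).Local v × (UnitaryGroup.cmDatum L 1 (Matrix.of fun i j : Fin 1 => if i.val + j.val + 1 = 1 then (1 : L) else 0)).Local v,
        MeasurableSpace (((UnitaryGroup.cmDatum L 2 (Matrix.of fun i j : Fin 2 => if i.val + j.val + 1 = 2 then (1 : L) else 0)).Local v × (UnitaryGroup.cmDatum L 1 (Matrix.of fun i j : Fin 1 => if i.val + j.val + 1 = 1 then (1 : L) else 0)).Local v) ⧸ Subgroup.centralizer ({a} : Set ((UnitaryGroup.cmDatum L 2 (Matrix.of fun i j : Fin 2 => if i.val + j.val + 1 = 2 then (1 : L) else 0)).Local v × (UnitaryGroup.cmDatum L 1 (Matrix.of fun i j : Fin 1 => if i.val + j.val + 1 = 1 then (1 : L) else 0)).Local v)))]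
      [∀ a : (UnitaryGroup.cmDatum L 2 (Matrix.of fun i j : Fin 2 => if i.val + j.val + 1 = 2 then (1 : L) else 0)).Local v × (UnitaryGroup.cmDatum L 1 (Matrix.of fun i j : Fin 1 => if i.val + j.val + 1 = 1 then (1 : L) else 0)).Local v,
        BorelSpace (((UnitaryGroup.cmDatum L 2 (Matrix.of fun i j : Fin 2 => if i.val + j.val + 1 = 2 then (1 : L) else 0)).Local v × (UnitaryGroup.cmDatum L 1 (Matrix.of fun i j : Fin 1 => if i.val + j.val + 1 = 1 then (1 : L) else 0)).Local v) ⧸ Subgroup.centralizer ({a} : Set ((UnitaryGroup.cmDatum L 2 (Matrix.of fun i j : Fin 2 => if i.val + j.val + 1 = 2 then (1 : L) else 0)).Local v × (UnitaryGroup.cmDatum L 1 (Matrix.of fun i j : Fin 1 => if i.val + j.val + 1 = 1 then (1 : L) else 0)).Local v)))]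
      [MeasurableSpace ((UnitaryGroup.cmDatum L 3 H').Local v)] [BorelSpace ((UnitaryGroup.cmDatum L 3 H').Local v)]
      [∀ γ : (UnitaryGroup.cmDatum L 3 H').Local v, MeasurableSpace ((UnitaryGroup.cmDatum L 3 H').Local v ⧸ Subgroup.centralizer ({γ} : Set ((UnitaryGroup.cmDatum L 3 H').Local v)))]
      [∀ γ : (UnitaryGroup.cmDatum L 3 H').Local v, BorelSpace ((UnitaryGroup.cmDatum L 3 H').Local v ⧸ Subgroup.centralizer ({γ} : Set ((UnitaryGroup.cmDatum L 3 H').Local v)))]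
      (νHv : Measure ((UnitaryGroup.cmDatum L 2 (Matrix.of fun i j : Fin 2 => if i.val + j.val + 1 = 2 then (1 : L) else 0)).Local v × (UnitaryGroup.cmDatum L 1 (Matrix.of fun i j : Fin 1 => if i.val + j.val + 1 = 1 then (1 : L) else 0)).Local v)) (νGv : Measure ((UnitaryGroup.cmDatum L 3 H').Local v))
      [IsFiniteMeasureOnCompacts νHv] [νHv.IsMulRightInvariant] [νGv.IsHaarMeasure] [νGv.IsMulRightInvariant]
      (Δv : LocalTransferFactor L H' v)
      (mHv : OrbitalMeasureFamily ((UnitaryGroup.cmDatum L 2 (Matrix.of fun i j : Fin 2 => if i.val + j.val + 1 = 2 then (1 : L) else 0)).Local v × (UnitaryGroup.cmDatum L 1 (Matrix.of fun i j : Fin 1 => if i.val + j.val + 1 = 1 then (1 : L) else 0)).Local v)) (mGv : OrbitalMeasureFamily ((UnitaryGroup.cmDatum L 3 H').Local v)),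
      IsLocalTransferDatum L H' v Δv mHv mGv →
      mHv.IsCanonical (IsLocalGRegular L v) νHv →
      mGv.IsCanonical (fun γ : (UnitaryGroup.cmDatum L 3 H').Local v => IsRegularElt (γ.val : GL (Fin 3) (UnitaryGroup.LocalRing L v))) νGv →
      Subsingleton (UnitaryGroup.PlacesOver L v) →
    ∀ z : (UnitaryGroup.cmDatum L 2 (Matrix.of fun i j : Fin 2 => if i.val + j.val + 1 = 2 then (1 : L) else 0)).Local v × (UnitaryGroup.cmDatum L 1 (Matrix.of fun i j : Fin 1 => if i.val + j.val + 1 = 1 then (1 : L) else 0)).Local v, z ∈ Subgroup.center ((UnitaryGroup.cmDatum L 2 (Matrix.of fun i j : Fin 2 => if i.val + j.val + 1 = 2 then (1 : L) else 0)).Local v × (UnitaryGroup.cmDatum L 1 (Matrix.of fun i j : Fin 1 => if i.val + j.val + 1 = 1 then (1 : L) else 0)).Local v) →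
    ∀ (S : Finset (ConjClasses ((UnitaryGroup.cmDatum L 2 (Matrix.of fun i j : Fin 2 => if i.val + j.val + 1 = 2 then (1 : L) else 0)).Local v × (UnitaryGroup.cmDatum L 1 (Matrix.of fun i j : Fin 1 => if i.val + j.val + 1 = 1 then (1 : L) else 0)).Local v))) (mU : OrbitalMeasureFamily ((UnitaryGroup.cmDatum L 2 (Matrix.of fun i j : Fin 2 => if i.val + j.val + 1 = 2 then (1 : L) else 0)).Local v × (UnitaryGroup.cmDatum L 1 (Matrix.of fun i j : Fin 1 => if i.val + j.val + 1 = 1 then (1 : L) else 0)).Local v))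
      (Γ : ConjClasses ((UnitaryGroup.cmDatum L 2 (Matrix.of fun i j : Fin 2 => if i.val + j.val + 1 = 2 then (1 : L) else 0)).Local v × (UnitaryGroup.cmDatum L 1 (Matrix.of fun i j : Fin 1 => if i.val + j.val + 1 = 1 then (1 : L) else 0)).Local v) → (UnitaryGroup.cmDatum L 2 (Matrix.of fun i j : Fin 2 => if i.val + j.val + 1 = 2 then (1 : L) else 0)).Local v × (UnitaryGroup.cmDatum L 1 (Matrix.of fun i j : Fin 1 => if i.val + j.val + 1 = 1 then (1 : L) else 0)).Local v → ℂ),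
      ConjClasses.mk z ∈ S →
      (∀ u ∈ S, ((((Quotient.out u * z⁻¹).1).val : GL (Fin 2) (UnitaryGroup.LocalRing L v)).val - 1) ^ 2 = 0 ∧ (Quotient.out u * z⁻¹).2 = 1) →
      mU.IsAdmissibleOn (fun γ : (UnitaryGroup.cmDatum L 2 (Matrix.of fun i j : Fin 2 => if i.val + j.val + 1 = 2 then (1 : L) else 0)).Local v × (UnitaryGroup.cmDatum L 1 (Matrix.of fun i j : Fin 1 => if i.val + j.val + 1 = 1 then (1 : L) else 0)).Local v => ConjClasses.mk γ ∈ S) →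
      (∀ u ∈ S, ∀ fH : (UnitaryGroup.cmDatum L 2 (Matrix.of fun i j : Fin 2 => if i.val + j.val + 1 = 2 then (1 : L) else 0)).Local v × (UnitaryGroup.cmDatum L 1 (Matrix.of fun i j : Fin 1 => if i.val + j.val + 1 = 1 then (1 : L) else 0)).Local v → ℂ, IsLocSmooth fH →
        Integrable (descConj (Quotient.out u : (UnitaryGroup.cmDatum L 2 (Matrix.of fun i j : Fin 2 => if i.val + j.val + 1 = 2 then (1 : L) else 0)).Local v × (UnitaryGroup.cmDatum L 1 (Matrix.of fun i j : Fin 1 => if i.val + j.val + 1 = 1 then (1 : L) else 0)).Local v) (Subgroup.centralizer ({(Quotient.out u : (UnitaryGroup.cmDatum L 2 (Matrix.of fun i j : Fin 2 => if i.val + j.val + 1 = 2 then (1 : L) else 0)).Local v × (UnitaryGroup.cmDatum L 1 (Matrix.of fun i j : Fin 1 => if i.val + j.val + 1 = 1 then (1 : L) else 0)).Local v)} : Set ((UnitaryGroup.cmDatum L 2 (Matrix.of fun i j : Fin 2 => if i.val + j.val + 1 = 2 then (1 : L) else 0)).Local v × (UnitaryGroup.cmDatum L 1 (Matrix.of fun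 i j : Fin 1 => if i.val + j.val + 1 = 1 then (1 : L) else 0)).Local v)))
          (fun _ hg => Subgroup.mem_centralizer_singleton_iff.1 hg) fH) (mU u)) →
      (∀ fH : (UnitaryGroup.cmDatum L 2 (Matrix.of fun i j : Fin 2 => if i.val + j.val + 1 = 2 then (1 : L) else 0)).Local v × (UnitaryGroup.cmDatum L 1 (Matrix.of fun i j : Fin 1 => if i.val + j.val + 1 = 1 then (1 : L) else 0)).Local v → ℂ, IsLocSmooth fH → ∀ᶠ γ in 𝓝[{γ : (UnitaryGroup.cmDatum L 2 (Matrix.of fun i j : Fin 2 => if i.val + j.val + 1 = 2 then (1 : L) else 0)).Local v × (UnitaryGroup.cmDatum L 1 (Matrix.of fun i j : Fin 1 => if i.val + j.val + 1 = 1 then (1 : L) else 0)).Local v |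
            IsLocalGRegular L v γ ∧ CompactSpace (Subgroup.centralizer ({γ} : Set ((UnitaryGroup.cmDatum L 2 (Matrix.of fun i j : Fin 2 => if i.val + j.val + 1 = 2 then (1 : L) else 0)).Local v × (UnitaryGroup.cmDatum L 1 (Matrix.of fun i j : Fin 1 => if i.val + j.val + 1 = 1 then (1 : L) else 0)).Local v)))}] z,
          stableOrbitalIntegralRel (IsLocalStablyConjH L v) mHv fH γ = ∑ u ∈ S, classOrbitalIntegral mU fH u * Γ u γ) →
    ∀ (c₀ : ℂ) (a : ConjClasses ((UnitaryGroup.cmDatum L 2 (Matrix.of fun i j : Fin 2 => if i.val + j.val + 1 = 2 then (1 : L) else 0)).Local v × (UnitaryGroup.cmDatum L 1 (Matrix.of fun i j : Fin 1 => if i.val + j.val + 1 = 1 then (1 : L) else 0)).Local v) → ℂ), a (ConjClasses.mk z) = 0 →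
      (∀ᶠ γ in 𝓝[{γ : (UnitaryGroup.cmDatum L 2 (Matrix.of fun i j : Fin 2 => if i.val + j.val + 1 = 2 then (1 : L) else 0)).Local v × (UnitaryGroup.cmDatum L 1 (Matrix.of fun i j : Fin 1 => if i.val + j.val + 1 = 1 then (1 : L) else 0)).Local v |
            IsLocalGRegular L v γ ∧ CompactSpace (Subgroup.centralizer ({γ} : Set ((UnitaryGroup.cmDatum L 2 (Matrix.of fun i j : Fin 2 => if i.val + j.val + 1 = 2 then (1 : L) else 0)).Local v × (UnitaryGroup.cmDatum L 1 (Matrix.of fun i j : Fin 1 => if i.val + j.val + 1 = 1 then (1 : L) else 0)).Local v)))}] z,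
        c₀ + ∑ u ∈ S, a u * Γ u γ = 0) → c₀ = 0  := by
  intro L _ _ _ H' hH' hH'a v _ _ _ _ _ _ _ _ νHv νGv _ _ _ _ Δv mHv mGv hLTD hcanH hcanG hns z hz S mU Γ hzS hunip hadm hint hexp c₀ a ha0 hev
  obtain ⟨γseq, q, e, g, n₀, hreg, hlim, hq, he, hhom⟩ :=
    hray L H' hH' hH'a v νHv νGv Δv mHv mGv hLTD hcanH hcanG hns z hz S mU Γ hzS hunip hadm hint hexp
  exact eq_zero_of_eventually_const_add_sum_eq_zero_of_ray S (ConjClasses.mk z) Γ γseq (fun n => hreg n) hlim q hq e he g n₀ hhom c₀ a ha0 hev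

end Summit.HodgeConjecture.HodgeConjecture.Cruxes.H413.K2E3CentralGermIndependenceOfHomogeneityRay

end
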